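import Literature.NumberTheory.DiophantineGeometry.GenEllAnnulus
import Literature.NumberTheory.DiophantineGeometry.GenEllVojtaCover
import HarnessLib

/-!
# [GenEll] Thm. 2.1 (ii) ⇒ (i) for `ℙ¹`: the bookkeeping of the noncritical-Belyi mechanism

S. Mochizuki, *Arithmetic elliptic curves in general position*, Math. J. Okayama Univ. 52 (2010)
[cite: MochizukiGenEll2010, Thm 2.1 p.13], proof of Thm. 2.1, pp. 12–13: with `φ : X → ℙ¹` the
noncritical Belyi map and `E = φ⁻¹(C)_red`,

> `ht_{ω_X} ≈ ht_{ω_X(E)} − ht_E ≈ ht_{ω_P(C)} − ht_E ≲ (1+ε')(log-diff_P + log-cond_C) − ht_E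
>  ≲ (1+ε')(log-diff_X + log-cond_E) − ht_E ≲ (1+ε')(log-diff_X + ht_E) − ht_E
>  ≈ (1+ε')·log-diff_X + ε'·ht_E ≈ (1+ε')·log-diff_X + ε'·(deg(E)/deg(ω_X))·ht_{ω_X}`,

preceded (p. 12) by the reduction along the Galois cover `Y → X`:
`log-diff_Y ≲ log-diff_X + log-cond_D` (Prop. 1.7 (i)).

This file proves the PURELY REAL bookkeeping of that chain in the tree's vocabulary for
`(ℙ¹, [0]+[1]+[∞])`, as one theorem whose hypotheses are exactly the deliverables of the work packages
of the `GenEllTwo` assembly (abc-iut cell, GENELLTWO-P1ROUTE §3): to every point `P` of the set `S`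
(degree `≤ d`) are attached two auxiliary points, `Q P` (a point of the cover over `P`, field
`ℚ(x, r)`) and `Z P` (the image `φ(Q P)`, presented over its minimal field, degree `≤ d'`), with

* (a) `Z P` is `ρ'`-far from the cusps at `∞` and at `2` (properness, W7) — so statement (ii) applies
  to it through the annulus (`vojtaIneq_farFromCusps_two`, W1);
* (b) `A·ht(P) ≤ ht(Z P) + c₁` (height machine for `β` and `t`: W6 + W4a; `A = deg β·(e+3)/e`);
* (c) `log-diff(Z P) + log-cond(Z P) ≤ log-diff(Q P) + κ(P)` (Prop. 1.7 (i) left along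
  `ℚ(Z) ⊆ ℚ(Q)`, S4's engine; `κ` = the conductor of `t(Q P)` along `B = β⁻¹{0,1,∞}`);
* (d) `κ(P) ≤ B_c·ht(P) + c₂` (sharp Prop. 1.6 on the cover, W5 + W4a;
  `B_c = ((deg β + 2)(e+3) − 3e − 3)/e`);
* (W3) `log-diff(Q P) ≤ log-diff(P) + log-cond(P) + c₃` (Prop. 1.7 (i) right for the Kummer cover,
  the tree's `NFPoint.logDiff_le_of_kummer_generator`);

and the slope condition `0 < A − (1+ε')·B_c` with `(1+ε')/(A − (1+ε')B_c) ≤ 1+ε` (Riemann–Hurwitz: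
`A − B_c = (e−3)/e`). Conclusion: `VojtaIneq S d ε`. Theorems only; no definitions, no named facts.
-/

noncomputable section

open NumberField

namespace Literature.NumberTheory.DiophantineGeometry.GenEll

/-- **The noncritical-Belyi mechanism, bookkeeping form** ([GenEll] pp. 12–13 for `ℙ¹`). Let `S` be a
set of points and `d, d'` degrees; suppose statement (ii) of Thm. 2.1 holds for `Σ = {2}`
(`ABCCompactlyBounded {2}`). Attach to each `P ∈ S ∩ U_P(Q̄)^{≤d}` auxiliary points `Q P`, `Z P` with
`Z P ∈ U_P(Q̄)^{≤d'}` `ρ'`-far from the cusps, and real constants with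
(b) `A·ht P ≤ ht(Z P) + c₁`, (c) `log-diff(Z P) + log-cond(Z P) ≤ log-diff(Q P) + κ P`,
(d) `κ P ≤ B_c·ht P + c₂`, (W3) `log-diff(Q P) ≤ log-diff P + log-cond P + c₃`,
and `0 < A − (1+ε')B_c`, `(1+ε')/(A − (1+ε')B_c) ≤ 1+ε` (`ε' > 0`). Then
`ht ≲ (1+ε)(log-diff + log-cond)` on `S ∩ U_P(Q̄)^{≤d}`, i.e. `VojtaIneq S d ε`.
[cite: MochizukiGenEll2010, Thm 2.1 p.13] -/
theorem vojtaIneq_of_belyi_mechanism (h2 : ABCCompactlyBounded ({2} : Finset ℕ))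
    {S : Set NFPoint} {d d' : ℕ} (hd' : 0 < d') {ε ε' ρ' : ℝ} (hε' : 0 < ε')
    (hρ'0 : 0 < ρ') (hρ'2 : ρ' ≤ 1 / 2)
    (Z Q : NFPoint → NFPoint) (κ : NFPoint → ℝ) {A Bc c₁ c₂ c₃ : ℝ}
    (hZmem : ∀ P ∈ S ∩ UPle d, Z P ∈ UPle d')
    (hZfar : ∀ P ∈ S ∩ UPle d, (Z P).FarFromCusps ({2} : Finset ℕ) ρ')
    (hZht : ∀ P ∈ S ∩ UPle d, A * P.ht ≤ (Z P).ht + c₁)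
    (hZcond : ∀ P ∈ S ∩ UPle d, (Z P).logDiff + (Z P).logCond ≤ (Q P).logDiff + κ P)
    (hκ : ∀ P ∈ S ∩ UPle d, κ P ≤ Bc * P.ht + c₂)
    (hQ : ∀ P ∈ S ∩ UPle d, (Q P).logDiff ≤ P.logDiff + P.logCond + c₃)
    (hslope : 0 < A - (1 + ε') * Bc) (hε : (1 + ε') / (A - (1 + ε') * Bc) ≤ 1 + ε) :
    VojtaIneq S d ε := by
  -- statement (ii) through the annulus at the auxiliary points `Z P`
  obtain ⟨C, hC⟩ := vojtaIneq_farFromCusps_two h2 hd' hε' hρ'0 hρ'2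
  -- the chain of pp. 12–13, as `(A − (1+ε')B_c)·ht P ≤ (1+ε')(log-diff P + log-cond P) + const`
  have key : BDLe (S ∩ UPle d) (fun P => (1 - (1 - (A - (1 + ε') * Bc))) * P.ht)
      (fun P => (1 + ε') * (P.logDiff + P.logCond)) := by
    refine ⟨C + c₁ + (1 + ε') * (c₂ + c₃), fun P hP => ?_⟩
    have hZ : Z P ∈ {P : NFPoint | P.FarFromCusps ({2} : Finset ℕ) ρ'} ∩ UPle d' :=
      ⟨hZfar P hP, hZmem P hP⟩
    have h1 : (Z P).ht - (1 + ε') * ((Z P).logDiff + (Z P).logCond) ≤ C := hC _ hZ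
    have h2' := hZht P hP
    have h3 := hZcond P hP
    have h4 := hκ P hP
    have h5 := hQ P hP
    have hε'1 : 0 ≤ 1 + ε' := by linarith
    have h6 : (1 + ε') * ((Z P).logDiff + (Z P).logCond) ≤
        (1 + ε') * (P.logDiff + P.logCond + c₃ + Bc * P.ht + c₂) := by
      refine mul_le_mul_of_nonneg_left ?_ hε'1
      linarith
    simp only
    nlinarith
  exact vojtaIneq_of_scaled (δ := 1 - (A - (1 + ε') * Bc)) (by linarith) (by simpa using hε) key

/-- **Riemann–Hurwitz slope**: with `A = deg β·(e+3)/e` and `B_c = ((deg β + 2)(e+3) − 3e − 3)/e`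
one has `A − B_c = (e − 3)/e` (`= (2g−2)/deg(D_e → ℙ¹)` for the cover `D_e : r^e = x(1−x)`,
`g = (e−1)/2`), the margin the mechanism runs on. [cite: MochizukiGenEll2010, Prop 1.7 (ii) p.10] -/
theorem slope_sub_eq (degβ e : ℝ) (he : e ≠ 0) :
    degβ * (e + 3) / e - ((degβ + 2) * (e + 3) - 3 * e - 3) / e = (e - 3) / e := by
  field_simp
  ring

/-- **Choice of `ε'`**: given `ε > 0`, a margin `m = (e−3)/e` with `1/m < 1 + ε` (i.e. `e/(e−3) < 1+ε`)
and any `B_c ≥ 0`, there is `ε' > 0` with `0 < m − ε'·B_c` and `(1+ε')/(m − ε'B_c) ≤ 1 + ε` — the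
"`ε'` sufficiently small" of p. 12. (Here `A − (1+ε')B_c = (A − B_c) − ε'B_c = m − ε'B_c`.)
[cite: MochizukiGenEll2010, Thm 2.1 p.12] -/
theorem exists_eps_of_margin {ε m Bc : ℝ} (hε : 0 < ε) (hm : 0 < m) (hmε : 1 / m < 1 + ε)
    (hBc : 0 ≤ Bc) : ∃ ε' : ℝ, 0 < ε' ∧ 0 < m - ε' * Bc ∧ (1 + ε') / (m - ε' * Bc) ≤ 1 + ε := by
  -- the gap `g := (1+ε)·m − 1 > 0`; take `ε'` with `ε' ≤ g/2` and `ε'·B_c·(1+ε) ≤ g/2`, `ε'·B_c ≤ m/2`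
  have hg : 0 < (1 + ε) * m - 1 := by
    have : 1 < (1 + ε) * m := by
      rw [div_lt_iff₀ hm] at hmε; linarith
    linarith
  set g := (1 + ε) * m - 1 with hgdef
  -- ε' := min (g/2) (min (m / (2 (B_c + 1))) (g / (2 (1+ε) (B_c + 1))))
  have hB1 : 0 < Bc + 1 := by linarith
  have h1ε : 0 < 1 + ε := by linarith
  refine ⟨min (g / 2) (min (m / (2 * (Bc + 1))) (g / (2 * (1 + ε) * (Bc + 1)))), ?_, ?_, ?_⟩
  · refine lt_min (by positivity) (lt_min (by positivity) (by positivity))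
  · -- `ε'·B_c ≤ (m/(2(B_c+1)))·B_c ≤ m/2`
    have hle : min (g / 2) (min (m / (2 * (Bc + 1))) (g / (2 * (1 + ε) * (Bc + 1)))) * Bc ≤
        m / (2 * (Bc + 1)) * Bc :=
      mul_le_mul_of_nonneg_right ((min_le_right _ _).trans (min_le_left _ _)) hBc
    have hle2 : m / (2 * (Bc + 1)) * Bc ≤ m / 2 := by
      rw [div_mul_eq_mul_div, div_le_div_iff₀ (by positivity) (by positivity)]
      nlinarith
    linarith
  · -- `(1+ε') ≤ (1+ε)(m − ε' B_c)` ⟸ `ε' ≤ g/2` and `(1+ε) ε' B_c ≤ g/2`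
    set ε' := min (g / 2) (min (m / (2 * (Bc + 1))) (g / (2 * (1 + ε) * (Bc + 1)))) with hε'def
    have hε'pos : 0 < ε' := lt_min (by positivity) (lt_min (by positivity) (by positivity))
    have hden : 0 < m - ε' * Bc := by
      have hle : ε' * Bc ≤ m / (2 * (Bc + 1)) * Bc :=
        mul_le_mul_of_nonneg_right ((min_le_right _ _).trans (min_le_left _ _)) hBc
      have hle2 : m / (2 * (Bc + 1)) * Bc ≤ m / 2 := by
        rw [div_mul_eq_mul_div, div_le_div_iff₀ (by positivity) (by positivity)]
        nlinarith
      linarith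
    rw [div_le_iff₀ hden]
    have ha : ε' ≤ g / 2 := min_le_left _ _
    have hb : (1 + ε) * (ε' * Bc) ≤ g / 2 := by
      have hle : ε' * Bc ≤ g / (2 * (1 + ε) * (Bc + 1)) * Bc :=
        mul_le_mul_of_nonneg_right ((min_le_right _ _).trans (min_le_right _ _)) hBc
      have hle2 : (1 + ε) * (g / (2 * (1 + ε) * (Bc + 1)) * Bc) ≤ g / 2 := by
        rw [div_mul_eq_mul_div, mul_div_assoc', div_le_div_iff₀ (by positivity) (by positivity)]
        nlinarith
      nlinarith
    nlinarith

end Literature.NumberTheory.DiophantineGeometry.GenEll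

end
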